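import Summits.NavierStokesRegularity.NavierStokesRegularity.Theses.TautLoopKelvin
import Literature.Analysis.FluidPDE.NSQuasipotential
import Literature.Analysis.FluidPDE.LerayLocalRegularH1Proofs

/-!
# Crux `TautLoopLaw` (stmt-NavierStokesRegularity-15249, route `TautLoopKelvin`), negative side:
# non-vacuity; the classical clause and the side condition `t₂ < T` are load-bearing
# (through the representative)

Negative-side (cdisprove, D-0016) lemmas extracted from the crux work file
`Cruxes/TautLoopLaw/Disproof.lean` (cycle 1, 2026-08-17), importable by the line's provers. Nothing here
closes the item (`--supports`); no theorem concludes a Theses statement positively.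

Notation: for a slice `v`, `ell v g` is the crux's inlined circulation–length spectrum
`⨅ {ofReal (len γ) : γ a C¹ loop, g ≤ |∮_γ v·dl|} ∈ ℝ≥0∞` and `rate v g` its inlined near-taut
compression rate `⨅_{ε>0} sSup {k(γ) : γ admissible, len γ ≤ ℓ + ε} ∈ ℝ`, both copied VERBATIM so
that they unfold definitionally into the crux text.

* `tautLoopLaw_hypotheses_satisfiable` — NON-VACUITY: the rest state (`ν = T = 1`) is classical on
  `[0, 1)`, Leray–Hopf from the rapidly decaying datum `0`; and `law_holds_at_rest`: there the
  conclusion holds at every level / pair of times / `M` (`ell 0 g = ⊤`, `⊤ * ofReal (exp (-M)) ≤ ⊤`).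
  The crux's conventions are not junk on this model: `ell_zero` (`⊤` on the empty class),
  `rate_zero_nonpos` (the `sSup` of the empty near-taut set is `0`, so `Φ = 0`, `M = 0` majorises a
  resting interval).
* `tautLoopLaw_false_without_classical` — with the clause `IsClassicalNSSolutionOn (Ico 0 T) ν 0 u p`
  DELETED the statement is FALSE. Witness: the rest state spiked at the single instant `t = 1/2` by
  the rigid rotation `rot` on the unit sphere `{‖x‖ = 1}` (Lebesgue-null). Every clause of
  `IsLerayHopfOn` reads slices a.e. (tree `isLerayHopfOn_zero`, `IsLerayHopfOn.congr_ae_slices`), so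
  the spiked family is Leray–Hopf from `0`; but the circulation functional reads the velocity on a
  curve, a null set: the unit circle of the `e0e1`-plane carries `∮ u(1/2)·dl = 2π` while every loop
  carries `0` at `t = 0`. With `Φ = 0`, `M = 0` the law would give `⊤ = ell (u 0) 1 * 1 ≤ ell (u (1/2)) 1 < ⊤`.
  For provers: the loop spectrum is not an a.e.-class quantity — weak / mild-class steps
  (weak–strong uniqueness, energy methods, slab regularity) must be returned to the continuous
  representative that only the classical clause supplies; and the `⊤`-clause of the law (no
  admissible loop at `t₁` ⇒ none at `t₂`, forced by `⊤ * ofReal (exp (-M)) = ⊤`) is exactly forward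
  uniqueness from rest inside the class.
* `tautLoopLaw_false_upto_terminal_time` — the side condition `t₂ < T` cannot be relaxed to
  `t₂ ≤ T`: the terminal slice `u T` is pinned only a.e. (weak `L²` limit), and the rest state on
  `[0, 1)` spiked on the unit sphere AT `t = T = 1` is classical on `Ico 0 1` (spike outside the time
  set: `isClassicalNSSolutionOn_of_eqOn_zero`), Leray–Hopf on `[0, 1]`, decaying datum, and violates the
  relaxed law from `t₁ = 0` to `t₂ = 1`.
-/

noncomputable section

open MeasureTheory Set Function Filter Metric Real
open scoped Topology RealInnerProductSpace ENNReal
open Literature.Analysis.FluidPDE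

namespace Summit.NavierStokesRegularity.NavierStokesRegularity.Theorems.TautLoopLaw.Negative

/-- Local notation for physical space `ℝ³ = EuclideanSpace ℝ (Fin 3)`. -/
local notation "ℝ³" => EuclideanSpace ℝ (Fin 3)

/-! ## §0 Frame, rotation field, the sphere-spiked rest state -/

/-- First coordinate vector. -/
def e0 : ℝ³ := EuclideanSpace.single 0 1

/-- Second coordinate vector. -/
def e1 : ℝ³ := EuclideanSpace.single 1 1

/-- The frame table: `e0`, `e1` are orthonormal (all six entries at once). -/
theorem frame_table :
    ‖e0‖ = 1 ∧ ‖e1‖ = 1 ∧ ⟪e0, e1⟫ = 0 ∧ ⟪e1, e0⟫ = 0 ∧ ⟪e0, e0⟫ = 1 ∧ ⟪e1, e1⟫ = 1 := by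
  have h0 : ‖e0‖ = 1 := by simp [e0]
  have h1 : ‖e1‖ = 1 := by simp [e1]
  have h01 : ⟪e0, e1⟫ = 0 := by simp [e0, e1, EuclideanSpace.inner_single_left]
  refine ⟨h0, h1, h01, by rw [real_inner_comm]; exact h01, ?_, ?_⟩
  · rw [real_inner_self_eq_norm_sq, h0]; norm_num
  · rw [real_inner_self_eq_norm_sq, h1]; norm_num

/-- Inner products of frame combinations. -/
theorem inner_frame (a b c d : ℝ) :
    ⟪a • e0 + b • e1, c • e0 + d • e1⟫ = a * c + b * d := by
  obtain ⟨-, -, h01, h10, h00, h11⟩ := frame_table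
  simp only [inner_add_left, inner_add_right, real_inner_smul_left, real_inner_smul_right,
    h00, h01, h10, h11]
  ring

/-- First frame coefficient. -/
theorem inner_frame_e0 (a b : ℝ) : ⟪a • e0 + b • e1, e0⟫ = a := by
  simpa using inner_frame a b 1 0

/-- Second frame coefficient. -/
theorem inner_frame_e1 (a b : ℝ) : ⟪a • e0 + b • e1, e1⟫ = b := by
  simpa using inner_frame a b 0 1

/-- Points of the unit circle of the `e0e1`-plane have norm one. -/
theorem norm_frame_cos_sin (θ : ℝ) : ‖cos θ • e0 + sin θ • e1‖ = 1 := by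
  have h : ‖cos θ • e0 + sin θ • e1‖ ^ 2 = 1 := by
    rw [← real_inner_self_eq_norm_sq, inner_frame]
    nlinarith [cos_sq_add_sin_sq θ]
  have h0 : 0 ≤ ‖cos θ • e0 + sin θ • e1‖ := norm_nonneg _
  nlinarith [h, h0]

/-- The rigid rotation about the `e2`-axis, written frame-free: `rot x = -⟪x,e1⟫ e0 + ⟪x,e0⟫ e1`. -/
def rot (x : ℝ³) : ℝ³ := (-⟪x, e1⟫) • e0 + ⟪x, e0⟫ • e1

/-- On the unit circle of the `e0e1`-plane the rotation field is the unit tangent. -/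
theorem rot_frame (θ : ℝ) : rot (cos θ • e0 + sin θ • e1) = (-sin θ) • e0 + cos θ • e1 := by
  simp only [rot, inner_frame_e0, inner_frame_e1]

/-- **The sphere-spiked rest state** with spike time `τ`: `u(t, x) = rot x` if `t = τ` and
`‖x‖ = 1`, and `0` otherwise — an a.e.-modification (unit sphere, one instant) of the rest state. -/
def spikeVel (τ : ℝ) : ℝ → ℝ³ → ℝ³ := fun t x => if t = τ ∧ ‖x‖ = 1 then rot x else 0

/-- Away from the spike time the spiked rest state is the rest state. -/
theorem spikeVel_of_ne {τ t : ℝ} (ht : t ≠ τ) : spikeVel τ t = 0 := by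
  funext x
  simp [spikeVel, ht]

/-- At the spike time, on the unit sphere, the spiked rest state is the rotation field. -/
theorem spikeVel_at_of_norm {τ : ℝ} {x : ℝ³} (hx : ‖x‖ = 1) : spikeVel τ τ x = rot x := by
  simp [spikeVel, hx]

/-- Off the unit sphere the spiked rest state vanishes at all times. -/
theorem spikeVel_of_norm_ne {τ t : ℝ} {x : ℝ³} (hx : ‖x‖ ≠ 1) : spikeVel τ t x = 0 := by
  simp [spikeVel, hx]

/-- Every slice of the spiked rest state vanishes off the unit sphere, hence a.e. -/
theorem spikeVel_slice_ae_eq (τ t : ℝ) : spikeVel τ t =ᵐ[volume] (0 : ℝ³ → ℝ³) := by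
  have hsub : {x : ℝ³ | ¬ spikeVel τ t x = (0 : ℝ³ → ℝ³) x} ⊆ sphere (0 : ℝ³) 1 := by
    intro x hx
    rw [mem_sphere_zero_iff_norm]
    by_contra h1
    exact hx (by rw [spikeVel_of_norm_ne h1]; rfl)
  rw [Filter.EventuallyEq, ae_iff]
  exact measure_mono_null hsub (Measure.addHaar_sphere volume 0 1)

/-- The spiked rest state vanishes a.e. in space–time (it is supported in `{τ} × ℝ³`). -/
theorem uncurry_spikeVel_ae_eq (τ : ℝ) : uncurry (spikeVel τ) =ᵐ[volume] (0 : ℝ × ℝ³ → ℝ³) := by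
  have hsub : {z : ℝ × ℝ³ | ¬ uncurry (spikeVel τ) z = (0 : ℝ × ℝ³ → ℝ³) z} ⊆ {τ} ×ˢ univ := by
    rintro ⟨t, x⟩ hx
    refine mk_mem_prod ?_ (mem_univ _)
    by_contra h0
    exact hx (by simp [uncurry, spikeVel_of_ne h0])
  rw [Filter.EventuallyEq, ae_iff]
  refine measure_mono_null hsub ?_
  rw [Measure.volume_eq_prod, Measure.prod_prod, measure_singleton, zero_mul]

/-- **The spiked rest state is Leray–Hopf from rest** on `[0, T)` for every `T > 0`, every
viscosity and every spike time `τ ≠ 0`: all clauses of `IsLerayHopfOn` are a.e.-stable in the slices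
(tree `isLerayHopfOn_zero`, `IsLerayHopfOn.congr_ae_slices`). -/
theorem isLerayHopfOn_spikeVel {τ T : ℝ} (hτ : τ ≠ 0) (hT : 0 < T) (ν : ℝ) :
    IsLerayHopfOn T ν 0 (spikeVel τ 0) (spikeVel τ) := by
  rw [spikeVel_of_ne hτ.symm]
  refine (isLerayHopfOn_zero T ν).congr_ae_slices hT ?_ fun t _ => spikeVel_slice_ae_eq τ t
  exact (aestronglyMeasurable_const.congr (uncurry_spikeVel_ae_eq τ).symm).restrict

/-- The datum of the spiked rest state (spike time `τ ≠ 0`) is the rapidly decaying `0`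
(namesakes of the decay of `0` live in other Negative folders; not imported, four lines). -/
theorem hasRapidSpatialDecay_spikeVel_zero {τ : ℝ} (hτ : τ ≠ 0) :
    HasRapidSpatialDecay (spikeVel τ 0) := by
  rw [spikeVel_of_ne hτ.symm]
  refine fun n K => ⟨0, fun x => ?_⟩
  have : iteratedFDeriv ℝ n (0 : ℝ³ → ℝ³) x = 0 := by
    rw [Pi.zero_def, iteratedFDeriv_fun_zero]; rfl
  rw [this, norm_zero, mul_zero]

/-- **A classical solution that is pointwise `0` on the time set is interchangeable with the rest
state**: if `u t = 0` for all `t ∈ S` then `(u, 0)` is a classical solution on `S` (joint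
smoothness is a `ContDiffOn` statement on `S ×ˢ univ`, the time derivative is `derivWithin _ S`). -/
theorem isClassicalNSSolutionOn_of_eqOn_zero {S : Set ℝ} {u : ℝ → ℝ³ → ℝ³}
    (hu : ∀ t ∈ S, u t = 0) (ν : ℝ) : IsClassicalNSSolutionOn S ν 0 u 0 where
  smooth_velocity := by
    unfold IsSmoothSpaceTimeOn
    refine (contDiffOn_const (c := (0 : ℝ³))).congr ?_
    rintro ⟨t, x⟩ htx
    simp [uncurry, hu t htx.1]
  smooth_pressure := (isClassicalNSSolutionOn_zero S ν (E := ℝ³)).smooth_pressure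
  momentum t ht x := by
    have h1 : timeDerivWithin S u t x = 0 := by
      rw [timeDerivWithin_apply]
      have : derivWithin (fun s => u s x) S t = derivWithin (fun _ : ℝ => (0 : ℝ³)) S t :=
        derivWithin_congr (fun s hs => by simp [hu s hs]) (by simp [hu t ht])
      rw [this, derivWithin_fun_const, Pi.zero_apply]
    have h0 := (isClassicalNSSolutionOn_zero S ν (E := ℝ³)).momentum t ht x
    have h2 : timeDerivWithin S (0 : ℝ → ℝ³ → ℝ³) t x = 0 := by simp [timeDerivWithin]
    rw [h2] at h0
    rw [h1, hu t ht]
    exact h0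
  divFree t ht := by
    rw [hu t ht]
    exact (isClassicalNSSolutionOn_zero S ν (E := ℝ³)).divFree t ht

/-- The spiked rest state with spike time `τ ∉ S` is classical on `S` (with pressure `0`). -/
theorem isClassicalNSSolutionOn_spikeVel {S : Set ℝ} {τ : ℝ} (hτ : τ ∉ S) (ν : ℝ) :
    IsClassicalNSSolutionOn S ν 0 (spikeVel τ) 0 :=
  isClassicalNSSolutionOn_of_eqOn_zero (fun _ ht => spikeVel_of_ne (ne_of_mem_of_not_mem ht hτ)) ν

/-- The unit circle of the `e0e1`-plane as a `C¹` loop. -/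
def unitCircle : ℝ → ℝ³ := circleLoop (0 : ℝ³) 1 e0 e1

/-- The unit circle is a closed `C¹` loop. -/
theorem isC1Loop_unitCircle : IsC1Loop unitCircle := isC1Loop_circleLoop _ _ _ _

/-- **The spike carries circulation `2π` on the unit circle**: at the spike time the velocity on the
circle is the unit tangent. -/
theorem circulation_spikeVel_at (τ : ℝ) : circulation (spikeVel τ τ) unitCircle = 2 * π := by
  rw [unitCircle, circulation_circleLoop]
  have hpt : ∀ θ : ℝ, ⟪spikeVel τ τ ((0 : ℝ³) + ((1 : ℝ) * cos θ) • e0 + ((1 : ℝ) * sin θ) • e1),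
      (-((1 : ℝ) * sin θ)) • e0 + ((1 : ℝ) * cos θ) • e1⟫ = (1 : ℝ) := by
    intro θ
    simp only [one_mul, zero_add]
    rw [spikeVel_at_of_norm (norm_frame_cos_sin θ), rot_frame, inner_frame]
    nlinarith [sin_sq_add_cos_sq θ]
  simp_rw [hpt]
  rw [intervalIntegral.integral_const]
  simp

/-- The unit circle is admissible at level `1` for the spike slice (`2π ≥ 1`). -/
theorem one_le_abs_circulation_spikeVel_at (τ : ℝ) :
    (1 : ℝ) ≤ |circulation (spikeVel τ τ) unitCircle| := by
  rw [circulation_spikeVel_at, abs_of_pos (by positivity)]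
  linarith [pi_gt_three]

/-! ## §1 The spectrum `ell` and the rate `rate` (verbatim from the crux); the rest state -/

/-- The circulation–length spectrum of a slice `v` at level `g`, VERBATIM the crux's inlined `⨅`. -/
def ell (v : ℝ³ → ℝ³) (g : ℝ) : ℝ≥0∞ :=
  ⨅ (γ' : ℝ → EuclideanSpace ℝ (Fin 3)) (_ : Literature.Analysis.FluidPDE.IsC1Loop γ' ∧ g ≤ |Literature.Analysis.FluidPDE.circulation v γ'|), ENNReal.ofReal (∫ σ in (0:ℝ)..1, ‖deriv γ' σ‖)

/-- The near-taut compression rate of a slice `v` at level `g`, VERBATIM the crux's inlined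
`⨅ ε, sSup {…}` (an `ℝ`-valued `⨅` of `ℝ`-valued `sSup`s: `0` on empty / unbounded sets). -/
def rate (v : ℝ³ → ℝ³) (g : ℝ) : ℝ :=
  ⨅ ε : {ε : ℝ // 0 < ε}, sSup {k : ℝ | ∃ γ : ℝ → EuclideanSpace ℝ (Fin 3), Literature.Analysis.FluidPDE.IsC1Loop γ ∧ g ≤ |Literature.Analysis.FluidPDE.circulation v γ| ∧ ENNReal.ofReal (∫ σ in (0:ℝ)..1, ‖deriv γ σ‖) ≤ (⨅ (γ' : ℝ → EuclideanSpace ℝ (Fin 3)) (_ : Literature.Analysis.FluidPDE.IsC1Loop γ' ∧ g ≤ |Literature.Analysis.FluidPDE.circulation v γ'|), ENNReal.ofReal (∫ σ in (0:ℝ)..1, ‖deriv γ' σ‖)) + ENNReal.ofReal (ε : ℝ) ∧ k = ((∫ σ in (0:ℝ)..1, -(inner ℝ (deriv γ σ) (fderiv ℝ v (γ σ) (deriv γ σ))) / ‖deriv γ σ‖) / (∫ σ in (0:ℝ)..1, ‖deriv γ σ‖))}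

/-- **At an irrotational (here: zero) slice the admissible class is empty and `ell = ⊤`.** -/
theorem ell_zero {g : ℝ} (hg : 0 < g) : ell (0 : ℝ³ → ℝ³) g = ⊤ := by
  unfold ell
  refine iInf_eq_top.2 fun γ => iInf_eq_top.2 fun h => ?_
  have h2 := h.2
  rw [circulation_zero_left, abs_zero] at h2
  exact absurd h2 (not_le.2 hg)

/-- **At a zero slice the near-taut rate is `≤ 0` (in fact `0`): the `sSup` of the empty set is `0`,
not junk-infinite — so `Φ = 0`, `M = 0` is an admissible majorant across a resting interval.** -/
theorem rate_zero_nonpos {g : ℝ} (hg : 0 < g) : rate (0 : ℝ³ → ℝ³) g ≤ 0 := by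
  unfold rate
  refine Real.iInf_nonpos' ⟨⟨1, one_pos⟩, Real.sSup_nonpos ?_⟩
  rintro k ⟨γ, -, hk, -, -⟩
  rw [circulation_zero_left, abs_zero] at hk
  exact absurd hk (not_le.2 hg)

/-- **Non-vacuity**: the hypotheses of the crux are met (rest state, `ν = T = 1`). -/
theorem tautLoopLaw_hypotheses_satisfiable :
    ∃ (ν T : ℝ) (u : ℝ → ℝ³ → ℝ³) (p : ℝ → ℝ³ → ℝ), 0 < ν ∧ 0 < T ∧
      IsClassicalNSSolutionOn (Ico 0 T) ν 0 u p ∧ IsLerayHopfOn T ν 0 (u 0) u ∧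
      HasRapidSpatialDecay (u 0) := by
  have hdec : HasRapidSpatialDecay ((0 : ℝ → ℝ³ → ℝ³) 0) := by
    have h := hasRapidSpatialDecay_spikeVel_zero (τ := 2) two_ne_zero
    rwa [spikeVel_of_ne (by norm_num : (0 : ℝ) ≠ 2)] at h
  exact ⟨1, 1, 0, 0, one_pos, one_pos, isClassicalNSSolutionOn_zero _ 1, isLerayHopfOn_zero 1 1, hdec⟩

/-- … and at the rest state the conclusion of the law holds for all levels, times and `M`
(`⊤ * ofReal (exp (-M)) ≤ ⊤`): the only constructible model does not refute the crux. -/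
theorem law_holds_at_rest {g : ℝ} (hg : 0 < g) (t₁ t₂ M : ℝ) :
    ell ((0 : ℝ → ℝ³ → ℝ³) t₁) g * ENNReal.ofReal (Real.exp (-M)) ≤ ell ((0 : ℝ → ℝ³ → ℝ³) t₂) g := by
  have h : ell ((0 : ℝ → ℝ³ → ℝ³) t₂) g = ⊤ := ell_zero hg
  rw [h]
  exact le_top

/-- The spectrum of the spike slice at level `1` is finite (the unit circle is admissible). -/
theorem ell_spikeVel_at_lt_top (τ : ℝ) : ell (spikeVel τ τ) 1 < ⊤ := by
  unfold ell
  exact (iInf₂_le unitCircle ⟨isC1Loop_unitCircle, one_le_abs_circulation_spikeVel_at τ⟩).trans_lt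
    ENNReal.ofReal_lt_top

/-- The spectrum of the spiked family away from the spike time is `⊤`. -/
theorem ell_spikeVel_of_ne {τ t : ℝ} (ht : t ≠ τ) {g : ℝ} (hg : 0 < g) : ell (spikeVel τ t) g = ⊤ := by
  rw [spikeVel_of_ne ht]; exact ell_zero hg

/-- The rate of the spiked family away from the spike time is `≤ 0`. -/
theorem rate_spikeVel_of_ne {τ t : ℝ} (ht : t ≠ τ) {g : ℝ} (hg : 0 < g) :
    rate (spikeVel τ t) g ≤ 0 := by
  rw [spikeVel_of_ne ht]; exact rate_zero_nonpos hg

/-! ## §2 The classical clause is load-bearing (through the representative) -/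

/-- The crux with the clause `IsClassicalNSSolutionOn (Set.Ico 0 T) ν 0 u p` DELETED (the pressure
`p` then disappears); everything else verbatim. -/
def TautLoopLawWithoutClassical : Prop :=
  ∀ (ν T : ℝ), 0 < ν → 0 < T → ∀ (u : ℝ → EuclideanSpace ℝ (Fin 3) → EuclideanSpace ℝ (Fin 3)), Literature.Analysis.FluidPDE.IsLerayHopfOn T ν 0 (u 0) u → Literature.Analysis.FluidPDE.HasRapidSpatialDecay (u 0) → ∀ g : ℝ, 0 < g → ∀ t₁ t₂ : ℝ, 0 ≤ t₁ → t₁ ≤ t₂ → t₂ < T → ∀ (Φ : ℝ → ℝ) (M : ℝ), Measurable Φ → 0 ≤ M → (∀ s ∈ Set.Ioo t₁ t₂, (⨅ ε : {ε : ℝ // 0 < ε}, sSup {k : ℝ | ∃ γ : ℝ → EuclideanSpace ℝ (Fin 3), Literature.Analysis.FluidPDE.IsC1Loop γ ∧ g ≤ |Literature.Analysis.FluidPDE.circulation (u s) γ| ∧ ENNReal.ofReal (∫ σ in (0:ℝ)..1, ‖deriv γ σ‖) ≤ (⨅ (γ' : ℝ → EuclideanSpace ℝ (Fin 3)) (_ :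 Literature.Analysis.FluidPDE.IsC1Loop γ' ∧ g ≤ |Literature.Analysis.FluidPDE.circulation (u s) γ'|), ENNReal.ofReal (∫ σ in (0:ℝ)..1, ‖deriv γ' σ‖)) + ENNReal.ofReal (ε : ℝ) ∧ k = ((∫ σ in (0:ℝ)..1, -(inner ℝ (deriv γ σ) (fderiv ℝ (u s) (γ σ) (deriv γ σ))) / ‖deriv γ σ‖) / (∫ σ in (0:ℝ)..1, ‖deriv γ σ‖))}) ≤ Φ s) → (∫⁻ s in Set.Ioo t₁ t₂, ENNReal.ofReal (Φ s)) ≤ ENNReal.ofReal M → (⨅ (γ' : ℝ → EuclideanSpace ℝ (Fin 3)) (_ : Literature.Analysis.FluidPDE.IsC1Loop γ' ∧ g ≤ |Literature.Analysis.FluidPDE.circulation (u t₁) γ'|), ENNReal.ofReal (∫ σ in (0:ℝ)..1, ‖deriv γ' σ‖)) * ENNReal.ofReal (Real.exp (-M)) ≤ (⨅ (γ' : ℝ → EuclideanSpace ℝ (Fin 3)) (_ : Literature.Analysis.FluidPDE.IsC1Loop γ' ∧ g ≤ |Literature.Analysis.FluidPDE.circulation (u t₂) γ'|), ENNReal.ofReal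 (∫ σ in (0:ℝ)..1, ‖deriv γ' σ‖))

/-- **`TautLoopLaw` is FALSE without its classical clause.** Witness: the rest state spiked by the
rigid rotation on the unit sphere at `t = 1/2` (`ν = T = 1`, `g = 1`, `t₁ = 0`, `t₂ = 1/2`, `Φ = 0`,
`M = 0`): Leray–Hopf from the decaying datum `0` (a.e.-invisible spike), rate `≤ 0` on `(0, 1/2)`
(resting slices), but `ℓ(u 0, 1) = ⊤` while the unit circle carries `|∮ u(1/2)·dl| = 2π ≥ 1`, so
`ℓ(u(1/2), 1) < ⊤` and `⊤ * 1 ≤ ℓ(u(1/2), 1)` fails. Any proof of the crux must use the continuous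
representative fixed by `IsClassicalNSSolutionOn`; its `⊤`-clause is forward uniqueness from rest. -/
theorem tautLoopLaw_false_without_classical : ¬ TautLoopLawWithoutClassical := by
  intro h
  have hτ : (1 / 2 : ℝ) ≠ 0 := by norm_num
  have key := h 1 1 one_pos one_pos (spikeVel (1 / 2)) (isLerayHopfOn_spikeVel hτ one_pos 1)
    (hasRapidSpatialDecay_spikeVel_zero hτ) 1 one_pos 0 (1 / 2) le_rfl (by norm_num) (by norm_num)
    (fun _ => 0) 0 measurable_const le_rfl
  refine absurd (key ?_ ?_) ?_
  · intro s hs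
    exact rate_spikeVel_of_ne (ne_of_lt hs.2) one_pos
  · simp
  · intro hc
    change ell (spikeVel (1 / 2) 0) 1 * ENNReal.ofReal (Real.exp (-0)) ≤ ell (spikeVel (1 / 2) (1 / 2)) 1
      at hc
    rw [ell_spikeVel_of_ne hτ.symm one_pos, neg_zero, Real.exp_zero, ENNReal.ofReal_one, mul_one] at hc
    exact lt_irrefl _ ((ell_spikeVel_at_lt_top (1 / 2)).trans_le hc)

/-! ## §3 Boundary: the side condition `t₂ < T` cannot be relaxed to `t₂ ≤ T` -/

/-- The crux with `t₂ < T` weakened to `t₂ ≤ T`; everything else verbatim. -/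
def TautLoopLawUptoT : Prop :=
  ∀ (ν T : ℝ), 0 < ν → 0 < T → ∀ (u : ℝ → EuclideanSpace ℝ (Fin 3) → EuclideanSpace ℝ (Fin 3)) (p : ℝ → EuclideanSpace ℝ (Fin 3) → ℝ), Literature.Analysis.FluidPDE.IsClassicalNSSolutionOn (Set.Ico 0 T) ν 0 u p → Literature.Analysis.FluidPDE.IsLerayHopfOn T ν 0 (u 0) u → Literature.Analysis.FluidPDE.HasRapidSpatialDecay (u 0) → ∀ g : ℝ, 0 < g → ∀ t₁ t₂ : ℝ, 0 ≤ t₁ → t₁ ≤ t₂ → t₂ ≤ T → ∀ (Φ : ℝ → ℝ) (M : ℝ), Measurable Φ → 0 ≤ M → (∀ s ∈ Set.Ioo t₁ t₂, (⨅ ε : {ε : ℝ // 0 < ε}, sSup {k : ℝ | ∃ γ : ℝ → EuclideanSpace ℝ (Fin 3), Literature.Analysis.FluidPDE.IsC1Loop γ ∧ g ≤ |Literature.Analysis.FluidPDE.circulation (u s) γ| ∧ ENNReal.ofReal (∫ σ in (0:ℝ)..1, ‖deriv γ σ‖) ≤ (⨅ (γ' : ℝ → EuclideanSpace ℝ (Fin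 3)) (_ : Literature.Analysis.FluidPDE.IsC1Loop γ' ∧ g ≤ |Literature.Analysis.FluidPDE.circulation (u s) γ'|), ENNReal.ofReal (∫ σ in (0:ℝ)..1, ‖deriv γ' σ‖)) + ENNReal.ofReal (ε : ℝ) ∧ k = ((∫ σ in (0:ℝ)..1, -(inner ℝ (deriv γ σ) (fderiv ℝ (u s) (γ σ) (deriv γ σ))) / ‖deriv γ σ‖) / (∫ σ in (0:ℝ)..1, ‖deriv γ σ‖))}) ≤ Φ s) → (∫⁻ s in Set.Ioo t₁ t₂, ENNReal.ofReal (Φ s)) ≤ ENNReal.ofReal M → (⨅ (γ' : ℝ → EuclideanSpace ℝ (Fin 3)) (_ : Literature.Analysis.FluidPDE.IsC1Loop γ' ∧ g ≤ |Literature.Analysis.FluidPDE.circulation (u t₁) γ'|), ENNReal.ofReal (∫ σ in (0:ℝ)..1, ‖deriv γ' σ‖)) * ENNReal.ofReal (Real.exp (-M)) ≤ (⨅ (γ' : ℝ → EuclideanSpace ℝ (Fin 3)) (_ : Literature.Analysis.FluidPDE.IsC1Loop γ' ∧ g ≤ |Literature.Analysis.FluidPDE.circulation (u t₂) γ'|),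 ENNReal.ofReal (∫ σ in (0:ℝ)..1, ‖deriv γ' σ‖))

/-- **The terminal slice is out of reach: `TautLoopLaw` with `t₂ ≤ T` is FALSE.** Witness: the rest
state on `[0, 1)` spiked on the unit sphere AT the terminal time `T = 1` is classical on `Ico 0 1`
(the spike is outside the time set), Leray–Hopf on `[0, 1]` (a.e.-invisible spike), decaying datum
`0`; from `t₁ = 0` to `t₂ = T = 1` with `Φ = 0`, `M = 0` the law would give `⊤ ≤ ℓ(u 1, 1) < ⊤`.
The terminal slice of a Leray–Hopf solution is pinned only a.e. (weak `L²` limit), so no loop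
functional of `u T` is meaningful: keep `t₂ < T` (as the deciding theorem does). -/
theorem tautLoopLaw_false_upto_terminal_time : ¬ TautLoopLawUptoT := by
  intro h
  have hτ : (1 : ℝ) ≠ 0 := one_ne_zero
  have hcl : IsClassicalNSSolutionOn (Set.Ico 0 1) 1 0 (spikeVel 1) 0 :=
    isClassicalNSSolutionOn_spikeVel (fun h1 => (lt_irrefl (1 : ℝ)) h1.2) 1
  have key := h 1 1 one_pos one_pos (spikeVel 1) 0 hcl (isLerayHopfOn_spikeVel hτ one_pos 1)
    (hasRapidSpatialDecay_spikeVel_zero hτ) 1 one_pos 0 1 le_rfl zero_le_one le_rfl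
    (fun _ => 0) 0 measurable_const le_rfl
  refine absurd (key ?_ ?_) ?_
  · intro s hs
    exact rate_spikeVel_of_ne (ne_of_lt hs.2) one_pos
  · simp
  · intro hc
    change ell (spikeVel 1 0) 1 * ENNReal.ofReal (Real.exp (-0)) ≤ ell (spikeVel 1 1) 1 at hc
    rw [ell_spikeVel_of_ne hτ.symm one_pos, neg_zero, Real.exp_zero, ENNReal.ofReal_one, mul_one] at hc
    exact lt_irrefl _ ((ell_spikeVel_at_lt_top 1).trans_le hc)

end Summit.NavierStokesRegularity.NavierStokesRegularity.Theorems.TautLoopLaw.Negative
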